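import Summits.QuantumFields.YangMills.Theorems.CurvatureBoostCovariance.Negative.Unbundled
import Summits.QuantumFields.YangMills.Theorems.MirrorModularBoostsCurvatureBoostCovarianceLevelGrowthLow
import Summits.QuantumFields.YangMills.Theorems.MirrorModularBoostsCurvatureBoostCovarianceOrbitAllAngles
import Literature.MathematicalPhysics.QuantumFieldTheory.SchwingerLimitInheritance
import Summits.QuantumFields.YangMills.Theses.MirrorModularBoosts
import HarnessLib

/-!
# `NPointIsotropy` — no layers under planar invariance; the shared level-growth bet follows from the sibling crux
(line `complex-rotation-bandlimit`)

Support file for crux `stmt-QuantumFields-11686` (`PencilRigidity.NPointIsotropy`).  The core certificate of the line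
proves the crux from three inputs shared with the sibling crux `MirrorModularBoosts.CurvatureBoostCovariance` (Step 0,
the doubled orbit kernel, level growth at levels `a ≥ 2`).  This file calibrates the third input.

* `noLayers_of_planarInvariant` — the converse engine: if `S₁` is planar-invariant on `⁰𝒮`, then for `e₀`-time-ordered
  `F`, `G` and any witness `H` of `ΘF* ⊗ G`, the orbit function `θ ↦ 𝔖_{n+m}(R_θ · H)` under the rotations `R_θ` of
  the `(x₀,x₁)`-plane (determinant one, fixing `e₂`, `e₃`) is CONSTANT (`H` is off-diagonal), so every layer `k ≠ 0`
  of a trigonometric representation `∑_{|k| ≤ K} p_k e^{4ikθ}` of it vanishes (`trigPoly_coeff_eq_zero_of_const`).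
* `levelGrowthHigh_of_curvatureBoostCovariance` — the SHARED level-growth statement (under `W1`, `EightFrameRP`,
  `PlanarCone`) is implied by the sibling crux `CurvatureBoostCovariance`: the crux unbundles (`crux_iff`) to
  `PlanarInvariant S₁` under exactly these hypotheses, and `noLayers_of_planarInvariant` with `G := F` kills every layer
  `k ≠ 0`, in particular `|k| ≥ 2`.  So, modulo Step 0 and the doubled orbit kernel, the shared bet is exactly as strong
  as the sibling crux (as its radial form is exactly as strong as this crux, `levelGrowthHighRadial_of_nPointIsotropy`).
[folklore]
-/

noncomputable section

namespace Summit.QuantumFields.YangMills.Theorems.NPointIsotropy.ComplexRotationBandlimit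

open scoped BigOperators SchwartzMap
open MeasureTheory Filter Topology
open Literature.MathematicalPhysics.QuantumLattice Literature.MathematicalPhysics.AQFT
  Literature.MathematicalPhysics.QuantumFieldTheory
open Summit.QuantumFields.YangMills.Theorems.CurvatureBoostCovariance.Negative
  (EightFrameRP PlanarCone PlanarInvariant W1 crux_iff)
open Summit.QuantumFields.YangMills.Theorems.CurvatureBoostCovariance.BoostsInheritMirrors
  (trigPoly_coeff_eq_zero_of_const)
open Summit.QuantumFields.YangMills.Theorems.CurvatureBoostCovariance.BoostsInheritMirrors.OrbitBandlimit
  (det_planeRot planeRot_single_two planeRot_single_three)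

/-- **No layers under planar invariance.**  If `S₁` is planar-invariant on `⁰𝒮`, then for `e₀`-time-ordered `F` (degree
`n`), `G` (degree `m`) and any witness `H` of `ΘF* ⊗ G` — which is off-diagonal
(`IsAppendTensorOf.isOffDiagonal_of_isTimeOrdered`) — the orbit function `θ ↦ 𝔖_{n+m}(R_θ · H)` under the plane
rotations `R_θ = planeRot 0 θ` (determinant one, fixing `e₂`, `e₃`: `det_planeRot`, `planeRot_single_two`,
`planeRot_single_three`) is constant, so every layer `k ≠ 0` of a trigonometric representation of it vanishes
(`trigPoly_coeff_eq_zero_of_const`). [folklore] -/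
theorem noLayers_of_planarInvariant : ∀ (S₁ : Literature.MathematicalPhysics.QuantumLattice.SchwingerFamily (EuclideanSpace ℝ (Fin 4))), Summit.QuantumFields.YangMills.Theorems.CurvatureBoostCovariance.Negative.PlanarInvariant S₁ → ∀ (n m : ℕ) (F : SchwartzMap (Fin n → EuclideanSpace ℝ (Fin 4)) ℂ) (G : SchwartzMap (Fin m → EuclideanSpace ℝ (Fin 4)) ℂ), Literature.MathematicalPhysics.QuantumLattice.IsTimeOrdered F → Literature.MathematicalPhysics.QuantumLattice.IsTimeOrdered G → ∀ H : SchwartzMap (Fin (n + m) → EuclideanSpace ℝ (Fin 4)) ℂ, Literature.MathematicalPhysics.QuantumLattice.IsAppendTensorOf H (Literature.MathematicalPhysics.QuantumLattice.osAdjoint F) G → ∀ (K : ℕ) (p : ℤ → ℂ), (∀ θ : ℝ, S₁ (n + m) (Literature.MathematicalPhysics.QuantumLattice.linActMulti (Literature.MathematicalPhysics.QuantumFieldTheory.planeRot (0 : Fin 3) θ) H) = ∑ k ∈ Finset.Icc (-(K : ℤ)) K, p k * Complex.exp (4 * (k : ℂ) * (θ : ℂ) * Complex.I)) → ∀ k ∈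 Finset.Icc (-(K : ℤ)) K, k ≠ 0 → p k = 0 := by
  intro S₁ hPI n m F G hF hG H hH K p hp
  have hHoff : IsOffDiagonal H := hH.isOffDiagonal_of_isTimeOrdered hF hG
  have hconst : ∀ θ : ℝ, S₁ (n + m) (linActMulti (planeRot (0 : Fin 3) θ) H) = S₁ (n + m) H := fun θ =>
    hPI (planeRot (0 : Fin 3) θ) (det_planeRot θ) (planeRot_single_two θ) (planeRot_single_three θ) (n + m) H hHoff
  exact trigPoly_coeff_eq_zero_of_const K p (S₁ (n + m) H) (fun θ => (hp θ).symm.trans (hconst θ))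

/-- **Planar invariance from the sibling crux, over arbitrary Borel instances.**  The sibling crux
`CurvatureBoostCovariance` is stated with the Borel σ-algebra `borel G` installed by `letI`; any
`[MeasurableSpace G] [BorelSpace G]` coincides with it (`BorelSpace.measurable_eq`), so the crux (`crux_iff`) applies
verbatim. [folklore] -/
theorem planarInvariant_of_curvatureBoostCovariance
    (hCBC : Summit.QuantumFields.YangMills.Theses.MirrorModularBoosts.CurvatureBoostCovariance)
    {G : Type} [Group G] [TopologicalSpace G] [IsTopologicalGroup G] [CompactSpace G] [MeasurableSpace G]
    [BorelSpace G] (hG : IsCompactSimpleLieGroup G) {r : LatticeRep G} {sch : SpeciesScheme (YMSpecies G)}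
    {S₁ : SchwingerFamily (EuclideanSpace ℝ (Fin 4))} (hW : W1 r sch S₁) (h8 : EightFrameRP S₁) (hC : PlanarCone S₁) :
    PlanarInvariant S₁ := by
  have hm : ‹MeasurableSpace G› = borel G := BorelSpace.measurable_eq
  subst hm
  exact (crux_iff.mp hCBC) G hG r sch S₁ hW h8 hC

/-- **The shared level-growth bet at levels `a ≥ 2` FOLLOWS from the sibling crux.**  From `CurvatureBoostCovariance` we
get `PlanarInvariant S₁` under `W1`, `EightFrameRP`, `PlanarCone` (`planarInvariant_of_curvatureBoostCovariance`), and
`noLayers_of_planarInvariant` with `G := F` kills every layer `k ≠ 0` — in particular `|k| ≥ 2` — of any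
trigonometric representation of the doubled orbit function.  The induction hypothesis (planar invariance in degrees
`≤ 2a − 2`), `2 ≤ a` and the compact support are carried and unused. [folklore] -/
theorem levelGrowthHigh_of_curvatureBoostCovariance : Summit.QuantumFields.YangMills.Theses.MirrorModularBoosts.CurvatureBoostCovariance → ∀ (G : Type) [Group G] [TopologicalSpace G] [IsTopologicalGroup G] [CompactSpace G] [MeasurableSpace G] [BorelSpace G], Literature.MathematicalPhysics.QuantumFieldTheory.IsCompactSimpleLieGroup G → ∀ (r : Literature.MathematicalPhysics.QuantumFieldTheory.LatticeRep G) (sch : Literature.MathematicalPhysics.QuantumFieldTheory.SpeciesScheme (Literature.MathematicalPhysics.QuantumFieldTheory.YMSpecies G)) (S₁ : Literature.MathematicalPhysics.QuantumLattice.SchwingerFamily (EuclideanSpace ℝ (Fin 4))), Summit.QuantumFields.YangMills.Theorems.CurvatureBoostCovariance.Negative.W1 r sch S₁ → Summit.QuantumFields.YangMills.Theorems.CurvatureBoostCovariance.Negative.EightFrameRP S₁ → Summit.QuantumFields.YangMills.Theorems.CurvatureBoostCovariance.Negative.PlanarCone S₁ → ∀ a : ℕ, 2 ≤ a → (∀ N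 : ℕ, N + 2 ≤ 2 * a → ∀ R : EuclideanSpace ℝ (Fin 4) ≃ₗᵢ[ℝ] EuclideanSpace ℝ (Fin 4), LinearMap.det (R.toLinearEquiv : EuclideanSpace ℝ (Fin 4) →ₗ[ℝ] EuclideanSpace ℝ (Fin 4)) = 1 → R (EuclideanSpace.single 2 1) = EuclideanSpace.single 2 1 → R (EuclideanSpace.single 3 1) = EuclideanSpace.single 3 1 → ∀ F : SchwartzMap (Fin N → EuclideanSpace ℝ (Fin 4)) ℂ, Literature.MathematicalPhysics.AQFT.IsOffDiagonal F → S₁ N (Literature.MathematicalPhysics.QuantumLattice.linActMulti R F) = S₁ N F) → ∀ (F : SchwartzMap (Fin a → EuclideanSpace ℝ (Fin 4)) ℂ), Literature.MathematicalPhysics.QuantumLattice.IsTimeOrdered F → HasCompactSupport (F : (Fin a → EuclideanSpace ℝ (Fin 4)) → ℂ) → ∀ H : SchwartzMap (Fin (a + a) → EuclideanSpace ℝ (Fin 4)) ℂ, Literature.MathematicalPhysics.QuantumLattice.IsAppendTensorOf H (Literature.MathematicalPhysics.QuantumLattice.osAdjoint F) F → ∀ (K : ℕ) (p : ℤ → ℂ),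 (∀ θ : ℝ, S₁ (a + a) (Literature.MathematicalPhysics.QuantumLattice.linActMulti (Literature.MathematicalPhysics.QuantumFieldTheory.planeRot (0 : Fin 3) θ) H) = ∑ k ∈ Finset.Icc (-(K : ℤ)) K, p k * Complex.exp (4 * (k : ℂ) * (θ : ℂ) * Complex.I)) → ∀ k ∈ Finset.Icc (-(K : ℤ)) K, 2 ≤ |k| → p k = 0 := by
  intro hCBC G _ _ _ _ _ _ hG r sch S₁ hW h8 hC a _ _ F hF _ H hH K p hp k hk hk2
  have hPI : PlanarInvariant S₁ := planarInvariant_of_curvatureBoostCovariance hCBC hG hW h8 hC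
  have hk0 : k ≠ 0 := by
    rintro rfl
    rw [abs_zero] at hk2
    exact absurd hk2 (by norm_num)
  exact noLayers_of_planarInvariant S₁ hPI a a F F hF hF H hH K p hp k hk hk0

end Summit.QuantumFields.YangMills.Theorems.NPointIsotropy.ComplexRotationBandlimit

end
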